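import Summits.MatrixMultiplication.OmegaCensus.DominoPartFiveZ4Z4
import Summits.MatrixMultiplication.OmegaCensus.DihedralLawModOneZ4Z4
import HarnessLib

/-!
# No `|A| ≡ 1 (mod 3)` law over `A ↠ ℤ₄ × ℤ₄` when `(|A|−1)/3` factors through parts `1, 3, 5`: the order `256`

ω-census `pub-omega`, family (b3), seat pub-omega-group gen 15.  Framing: lottery ticket; floor = certified bounds/negative
ranges.  VALUE: kernel theorems about the group-theoretic method (TPP capacity of dihedral-like groups); NOT progress on ω.

Gen 14's `no_mod_one_law_of_onto_z4z4` (`DihedralLawModOneZ4Z4.lean`) kills every TPP triple attaining `3|S||T||U| + 8 = 8|A|`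
over `A ↠ ℤ₄²` provided every factorisation `cde = (|A|−1)/3` has two parts `1` or a part `1` next to a part `3`.  With the
part-`5` theorem `no_law_cube_15e_of_onto_z4z4` / `no_law_cube_1d5_of_onto_z4z4` (`DominoPartFiveZ4Z4.lean`) the
factorisation property may also contain 'a part `1` next to a part `5`':

* `no_mod_one_law_of_onto_z4z4_five` — the extended assembly;
* `no_mod_one_law_card_256_of_onto_z4z4` (`(256−1)/3 = 85 = 5·17`) and the instances **`no_mod_one_law_z4_z64`,
  `no_mod_one_law_z8_z32`, `no_mod_one_law_z16_z16`**: the three abelian groups of order `256` of `2`-rank `2` without an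
  element of order `≥ 128` — census row NR68 (engine ×2) is now a KERNEL theorem; with `no_mod_one_law_of_rank_three` the
  order-`256` line of the Dih classification ('law ⟹ element of order ≥ |A|/2') is complete in the kernel.
-/

namespace Summit.MatrixMultiplication.OmegaCensus

open Finset

/-! ## Arithmetic: factorisations of `85` -/

section Arith

/-- `cde = 85 = 5·17`: two parts `1`, or a part `1` next to a part `3` (vacuous), or a part `1` next to a part `5`.
[folklore] -/
theorem cube_factor_135_of_256 {c d e : ℕ} (h : 3 * (c * d * e) + 1 = 256) :
    ((c = 1 ∧ d = 1) ∨ (d = 1 ∧ e = 1) ∨ (c = 1 ∧ e = 1) ∨ (c = 1 ∧ d = 3) ∨ (c = 1 ∧ e = 3) ∨ (d = 1 ∧ c = 3) ∨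
      (d = 1 ∧ e = 3) ∨ (e = 1 ∧ c = 3) ∨ (e = 1 ∧ d = 3)) ∨
    ((c = 1 ∧ d = 5) ∨ (c = 1 ∧ e = 5) ∨ (d = 1 ∧ c = 5) ∨ (d = 1 ∧ e = 5) ∨ (e = 1 ∧ c = 5) ∨ (e = 1 ∧ d = 5)) := by
  have hcde : c * (d * e) = 85 := by rw [← mul_assoc]; omega
  have hc : c ∈ Nat.divisors 85 := Nat.mem_divisors.2 ⟨Dvd.intro _ hcde, by norm_num⟩
  have hd : d ∈ Nat.divisors 85 :=
    Nat.mem_divisors.2 ⟨Dvd.intro (c * e) (by rw [← hcde]; ring), by norm_num⟩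
  rw [show Nat.divisors 85 = {1, 5, 17, 85} from by decide] at hc hd
  simp only [Finset.mem_insert, Finset.mem_singleton] at hc hd
  rcases hc with rfl | rfl | rfl | rfl <;> rcases hd with rfl | rfl | rfl | rfl <;> omega

end Arith

/-! ## Assembly -/

section DihedralLike

variable {A : Type} [AddCommGroup A] [DecidableEq A] [Fintype A] {G : Type} [Group G] [DecidableEq G]
  {ρ τ : A → G} {c₀ : A} {S T U : Finset G}

open Literature.Combinatorics.Additive

/-- **No `|A| ≡ 1 (mod 3)` law over `A ↠ ℤ₄ × ℤ₄`, under the extended factorisation property** (every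
`cde = (|A| − 1)/3` has two parts `1`, or a part `1` next to a part `3`, or a part `1` next to a part `5`): for every TPP triple
of a dihedral-like group over `A` (any `c₀`), `3|S||T||U| + 8 ≠ 8|A|`. [folklore] -/
theorem no_mod_one_law_of_onto_z4z4_five
    (hρρ : ∀ a b, ρ a * ρ b = ρ (a + b)) (hρτ : ∀ a b, ρ a * τ b = τ (b - a))
    (hτρ : ∀ a b, τ a * ρ b = τ (a + b)) (hττ : ∀ a b, τ a * τ b = ρ (c₀ + b - a))
    (hρ : Function.Injective ρ) (hτ : Function.Injective τ) (hne : ∀ a b, ρ a ≠ τ b)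
    (hsurj : ∀ g, (∃ a, ρ a = g) ∨ (∃ a, τ a = g)) (hA : 14 ≤ Fintype.card A)
    (φ : A →+ ZMod 4 × ZMod 4) (hφ : Function.Surjective φ)
    (hq : ∀ c d e : ℕ, 3 * (c * d * e) + 1 = Fintype.card A →
      ((c = 1 ∧ d = 1) ∨ (d = 1 ∧ e = 1) ∨ (c = 1 ∧ e = 1) ∨ (c = 1 ∧ d = 3) ∨ (c = 1 ∧ e = 3) ∨ (d = 1 ∧ c = 3) ∨
        (d = 1 ∧ e = 3) ∨ (e = 1 ∧ c = 3) ∨ (e = 1 ∧ d = 3)) ∨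
      ((c = 1 ∧ d = 5) ∨ (c = 1 ∧ e = 5) ∨ (d = 1 ∧ c = 5) ∨ (d = 1 ∧ e = 5) ∨ (e = 1 ∧ c = 5) ∨ (e = 1 ∧ d = 5)))
    (h : TripleProductProperty S T U) : 3 * (S.card * T.card * U.card) + 8 ≠ 8 * Fintype.card A := by
  intro hV
  have hmod : Fintype.card A % 3 = 1 := by omega
  have hV_TUS : 3 * (T.card * U.card * S.card) + 8 = 8 * Fintype.card A := by
    rw [show T.card * U.card * S.card = S.card * T.card * U.card by ring]; exact hV
  have hV_UST : 3 * (U.card * S.card * T.card) + 8 = 8 * Fintype.card A := by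
    rw [show U.card * S.card * T.card = S.card * T.card * U.card by ring]; exact hV
  have hTUS : TripleProductProperty T U S := h.rotate
  have hUST : TripleProductProperty U S T := h.rotate.rotate
  by_cases hnc : ((univ.filter fun a : A => ρ a ∈ S).card = (univ.filter fun a : A => τ a ∈ S).card ∧
      (univ.filter fun a : A => ρ a ∈ T).card = (univ.filter fun a : A => τ a ∈ T).card ∧
      (univ.filter fun a : A => ρ a ∈ U).card = (univ.filter fun a : A => τ a ∈ U).card)
  · obtain ⟨hS', hT', hU'⟩ := hnc
    have cS := card_eq_parts' hρ hτ hne hsurj S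
    have cT := card_eq_parts' hρ hτ hne hsurj T
    have cU := card_eq_parts' hρ hτ hne hsurj U
    set s₀ := (univ.filter fun a : A => ρ a ∈ S).card with hs₀
    set t₀ := (univ.filter fun a : A => ρ a ∈ T).card with ht₀
    set u₀ := (univ.filter fun a : A => ρ a ∈ U).card with hu₀
    have eS : S.card = 2 * s₀ := by rw [cS, ← hS']; ring
    have eT : T.card = 2 * t₀ := by rw [cT, ← hT']; ring
    have eU : U.card = 2 * u₀ := by rw [cU, ← hU']; ring
    have hprod : 3 * (s₀ * t₀ * u₀) + 1 = Fintype.card A := by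
      rw [eS, eT, eU] at hV; nlinarith
    rcases hq s₀ t₀ u₀ hprod with h13 | h15
    · rcases h13 with ⟨h1, h1'⟩ | ⟨h1, h1'⟩ | ⟨h1, h1'⟩ | ⟨h1, h1'⟩ | ⟨h1, h1'⟩ | ⟨h1, h1'⟩ |
          ⟨h1, h1'⟩ | ⟨h1, h1'⟩ | ⟨h1, h1'⟩
      · obtain ⟨g, a, b, hab⟩ := two_cosets_of_two_two_law hρρ hρτ hτρ hττ hρ hτ hne hsurj hmod (by omega) h
          (by rw [eS, h1]) (by rw [eT, h1']) hV
        exact not_two_cosets_of_onto_z4z4 φ hφ g a b hab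
      · obtain ⟨g, a, b, hab⟩ := two_cosets_of_two_two_law hρρ hρτ hτρ hττ hρ hτ hne hsurj hmod (by omega) hTUS
          (by rw [eT, h1]) (by rw [eU, h1']) hV_TUS
        exact not_two_cosets_of_onto_z4z4 φ hφ g a b hab
      · obtain ⟨g, a, b, hab⟩ := two_cosets_of_two_two_law hρρ hρτ hτρ hττ hρ hτ hne hsurj hmod (by omega) hUST
          (by rw [eU, h1']) (by rw [eS, h1]) hV_UST
        exact not_two_cosets_of_onto_z4z4 φ hφ g a b hab
      · exact no_law_cube_13e_of_onto_z4z4 hρρ hρτ hτρ hττ hρ hτ hne hsurj φ hφ h h1 (hS' ▸ h1) h1' (hT' ▸ h1')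
          hU' hV
      · exact no_law_cube_1d3_of_onto_z4z4 hρρ hρτ hτρ hττ hρ hτ hne hsurj φ hφ h h1 (hS' ▸ h1) hT' h1'
          (hU' ▸ h1') hV
      · exact no_law_cube_1d3_of_onto_z4z4 hρρ hρτ hτρ hττ hρ hτ hne hsurj φ hφ hTUS h1 (hT' ▸ h1) hU' h1'
          (hS' ▸ h1') hV_TUS
      · exact no_law_cube_13e_of_onto_z4z4 hρρ hρτ hτρ hττ hρ hτ hne hsurj φ hφ hTUS h1 (hT' ▸ h1) h1' (hU' ▸ h1')
          hS' hV_TUS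
      · exact no_law_cube_13e_of_onto_z4z4 hρρ hρτ hτρ hττ hρ hτ hne hsurj φ hφ hUST h1 (hU' ▸ h1) h1' (hS' ▸ h1')
          hT' hV_UST
      · exact no_law_cube_1d3_of_onto_z4z4 hρρ hρτ hτρ hττ hρ hτ hne hsurj φ hφ hUST h1 (hU' ▸ h1) hS' h1'
          (hT' ▸ h1') hV_UST
    · rcases h15 with ⟨h1, h1'⟩ | ⟨h1, h1'⟩ | ⟨h1, h1'⟩ | ⟨h1, h1'⟩ | ⟨h1, h1'⟩ | ⟨h1, h1'⟩
      · exact no_law_cube_15e_of_onto_z4z4 hρρ hρτ hτρ hττ hρ hτ hne hsurj φ hφ h h1 (hS' ▸ h1) h1' (hT' ▸ h1')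
          hU' hV
      · exact no_law_cube_1d5_of_onto_z4z4 hρρ hρτ hτρ hττ hρ hτ hne hsurj φ hφ h h1 (hS' ▸ h1) hT' h1'
          (hU' ▸ h1') hV
      · exact no_law_cube_1d5_of_onto_z4z4 hρρ hρτ hτρ hττ hρ hτ hne hsurj φ hφ hTUS h1 (hT' ▸ h1) hU' h1'
          (hS' ▸ h1') hV_TUS
      · exact no_law_cube_15e_of_onto_z4z4 hρρ hρτ hτρ hττ hρ hτ hne hsurj φ hφ hTUS h1 (hT' ▸ h1) h1' (hU' ▸ h1')
          hS' hV_TUS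
      · exact no_law_cube_15e_of_onto_z4z4 hρρ hρτ hτρ hττ hρ hτ hne hsurj φ hφ hUST h1 (hU' ▸ h1) h1' (hS' ▸ h1')
          hT' hV_UST
      · exact no_law_cube_1d5_of_onto_z4z4 hρρ hρτ hτρ hττ hρ hτ hne hsurj φ hφ hUST h1 (hU' ▸ h1) hS' h1'
          (hT' ▸ h1') hV_UST
  · obtain ⟨g, a, b, hab⟩ :=
      two_cosets_of_mod_one_law_of_not_cube hρρ hρτ hτρ hττ hρ hτ hne hsurj hmod hA h hV hnc
    exact not_two_cosets_of_onto_z4z4 φ hφ g a b hab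


/-- **`|A| = 256`, `A ↠ ℤ₄ × ℤ₄` (`ℤ₄ × ℤ₆₄`, `ℤ₈ × ℤ₃₂`, `ℤ₁₆²`, and the `2`-rank-`≥ 3` groups containing `ℤ₄²`): no
dihedral-like group over `A` (any `c₀`) attains `3|S||T||U| + 8 = 8|A|`** (`(256−1)/3 = 85 = 5·17`). [folklore] -/
theorem no_mod_one_law_card_256_of_onto_z4z4
    (hρρ : ∀ a b, ρ a * ρ b = ρ (a + b)) (hρτ : ∀ a b, ρ a * τ b = τ (b - a))
    (hτρ : ∀ a b, τ a * ρ b = τ (a + b)) (hττ : ∀ a b, τ a * τ b = ρ (c₀ + b - a))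
    (hρ : Function.Injective ρ) (hτ : Function.Injective τ) (hne : ∀ a b, ρ a ≠ τ b)
    (hsurj : ∀ g, (∃ a, ρ a = g) ∨ (∃ a, τ a = g)) (hA : Fintype.card A = 256)
    (φ : A →+ ZMod 4 × ZMod 4) (hφ : Function.Surjective φ) (h : TripleProductProperty S T U) :
    3 * (S.card * T.card * U.card) + 8 ≠ 8 * Fintype.card A :=
  no_mod_one_law_of_onto_z4z4_five hρρ hρτ hτρ hττ hρ hτ hne hsurj (by rw [hA]; norm_num) φ hφ
    (fun c d e hcde => cube_factor_135_of_256 (by rw [hcde, hA])) h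

end DihedralLike

/-! ## Instances: the three order-`256` groups of `2`-rank `2` without an element of order `≥ 128` (NR68) -/

section Instances

variable {G : Type} [Group G] [DecidableEq G] {S T U : Finset G}

open Literature.Combinatorics.Additive

/-- The reduction `ℤ₄ × ℤ₆₄ ↠ ℤ₄ × ℤ₄`. [folklore] -/
theorem z4_z64_onto_z4z4 : Function.Surjective
    ((AddMonoidHom.id (ZMod 4)).prodMap
      (ZMod.castHom (show 4 ∣ 64 by norm_num) (ZMod 4)).toAddMonoidHom : ZMod 4 × ZMod 64 →+ ZMod 4 × ZMod 4) := by
  intro q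
  obtain ⟨b, hb⟩ := ZMod.castHom_surjective (show 4 ∣ 64 by norm_num) (n := 64) q.2
  exact ⟨(q.1, b), Prod.ext rfl hb⟩

/-- The reduction `ℤ₈ × ℤ₃₂ ↠ ℤ₄ × ℤ₄`. [folklore] -/
theorem z8_z32_onto_z4z4 : Function.Surjective
    ((ZMod.castHom (show 4 ∣ 8 by norm_num) (ZMod 4)).toAddMonoidHom.prodMap
      (ZMod.castHom (show 4 ∣ 32 by norm_num) (ZMod 4)).toAddMonoidHom : ZMod 8 × ZMod 32 →+ ZMod 4 × ZMod 4) := by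
  intro q
  obtain ⟨a, ha⟩ := ZMod.castHom_surjective (show 4 ∣ 8 by norm_num) (n := 8) q.1
  obtain ⟨b, hb⟩ := ZMod.castHom_surjective (show 4 ∣ 32 by norm_num) (n := 32) q.2
  exact ⟨(a, b), Prod.ext ha hb⟩

/-- The reduction `ℤ₁₆ × ℤ₁₆ ↠ ℤ₄ × ℤ₄`. [folklore] -/
theorem z16_z16_onto_z4z4 : Function.Surjective
    ((ZMod.castHom (show 4 ∣ 16 by norm_num) (ZMod 4)).toAddMonoidHom.prodMap
      (ZMod.castHom (show 4 ∣ 16 by norm_num) (ZMod 4)).toAddMonoidHom : ZMod 16 × ZMod 16 →+ ZMod 4 × ZMod 4) := by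
  intro q
  obtain ⟨a, ha⟩ := ZMod.castHom_surjective (show 4 ∣ 16 by norm_num) (n := 16) q.1
  obtain ⟨b, hb⟩ := ZMod.castHom_surjective (show 4 ∣ 16 by norm_num) (n := 16) q.2
  exact ⟨(a, b), Prod.ext ha hb⟩

/-- **`ℤ₄ × ℤ₆₄`: no dihedral-like group over it (any `c₀`; `c₀ = 0` is `Dih(ℤ₄ × ℤ₆₄)`) has a TPP triple with
`3|S||T||U| + 8 = 8 · 256`** — census row NR68 as a kernel theorem. [folklore] -/
theorem no_mod_one_law_z4_z64 {ρ τ : ZMod 4 × ZMod 64 → G} {c₀ : ZMod 4 × ZMod 64}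
    (hρρ : ∀ a b, ρ a * ρ b = ρ (a + b)) (hρτ : ∀ a b, ρ a * τ b = τ (b - a))
    (hτρ : ∀ a b, τ a * ρ b = τ (a + b)) (hττ : ∀ a b, τ a * τ b = ρ (c₀ + b - a))
    (hρ : Function.Injective ρ) (hτ : Function.Injective τ) (hne : ∀ a b, ρ a ≠ τ b)
    (hsurj : ∀ g, (∃ a, ρ a = g) ∨ (∃ a, τ a = g)) (h : TripleProductProperty S T U) :
    3 * (S.card * T.card * U.card) + 8 ≠ 8 * Fintype.card (ZMod 4 × ZMod 64) :=
  no_mod_one_law_card_256_of_onto_z4z4 hρρ hρτ hτρ hττ hρ hτ hne hsurj (by simp) _ z4_z64_onto_z4z4 h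

/-- **`ℤ₈ × ℤ₃₂`: no dihedral-like group over it (any `c₀`) has a TPP triple with `3|S||T||U| + 8 = 8 · 256`** (NR68).
[folklore] -/
theorem no_mod_one_law_z8_z32 {ρ τ : ZMod 8 × ZMod 32 → G} {c₀ : ZMod 8 × ZMod 32}
    (hρρ : ∀ a b, ρ a * ρ b = ρ (a + b)) (hρτ : ∀ a b, ρ a * τ b = τ (b - a))
    (hτρ : ∀ a b, τ a * ρ b = τ (a + b)) (hττ : ∀ a b, τ a * τ b = ρ (c₀ + b - a))
    (hρ : Function.Injective ρ) (hτ : Function.Injective τ) (hne : ∀ a b, ρ a ≠ τ b)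
    (hsurj : ∀ g, (∃ a, ρ a = g) ∨ (∃ a, τ a = g)) (h : TripleProductProperty S T U) :
    3 * (S.card * T.card * U.card) + 8 ≠ 8 * Fintype.card (ZMod 8 × ZMod 32) :=
  no_mod_one_law_card_256_of_onto_z4z4 hρρ hρτ hτρ hττ hρ hτ hne hsurj (by simp) _ z8_z32_onto_z4z4 h

/-- **`ℤ₁₆ × ℤ₁₆`: no dihedral-like group over it (any `c₀`) has a TPP triple with `3|S||T||U| + 8 = 8 · 256`** (NR68).
[folklore] -/
theorem no_mod_one_law_z16_z16 {ρ τ : ZMod 16 × ZMod 16 → G} {c₀ : ZMod 16 × ZMod 16}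
    (hρρ : ∀ a b, ρ a * ρ b = ρ (a + b)) (hρτ : ∀ a b, ρ a * τ b = τ (b - a))
    (hτρ : ∀ a b, τ a * ρ b = τ (a + b)) (hττ : ∀ a b, τ a * τ b = ρ (c₀ + b - a))
    (hρ : Function.Injective ρ) (hτ : Function.Injective τ) (hne : ∀ a b, ρ a ≠ τ b)
    (hsurj : ∀ g, (∃ a, ρ a = g) ∨ (∃ a, τ a = g)) (h : TripleProductProperty S T U) :
    3 * (S.card * T.card * U.card) + 8 ≠ 8 * Fintype.card (ZMod 16 × ZMod 16) :=
  no_mod_one_law_card_256_of_onto_z4z4 hρρ hρτ hτρ hττ hρ hτ hne hsurj (by simp) _ z16_z16_onto_z4z4 h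

end Instances

end Summit.MatrixMultiplication.OmegaCensus
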